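import Summits.QuantumFields.YangMills.Theses.PencilRigidity

/-!
# `DiagonalMirrorRPR` — negative lemma: diagonal reflection positivity is ACTION-specific
# (the ℓ¹-Gaussian: axis-RP in every axis, `W(B₄)`-symmetric, gapped, an honest RP lattice scaling limit,
# NOT diagonally RP — exact two-point certificate)

Supports crux item `stmt-QuantumFields-10604` (`PencilRigidity.DiagonalMirrorRPR` =
`MirrorModularBoosts.DiagonalMirrorRPR`; standing-disprover work file
`Cruxes/DiagonalMirrorRPR/Disproof.lean`, §9, cycle 3).

**Natural strengthening refuted (kernel level).** "A translation-invariant two-point function on `ℤ⁴`/`ℝ⁴`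
that is reflection positive across the AXIS mirrors, invariant under the signed permutations `W(B₄)` and
exponentially clustering is reflection positive across the diagonal mirror `x₀ + x₁ = 0`" — FALSE for the
ℓ¹-Gaussian two-point function `C(x) = e^{-m‖x‖₁}`, here at lattice points with `ma = log 2`:
`K(v) = 2^{-‖v‖₁}` on the `(x₀,x₁)`-plane (`x₂, x₃` spectators).

* `kernelRP_l1_axis`: `K` is RP across the axis mirror `x₀ = 0` on EVERY finite configuration in `{x₀ > 0}`
  (`K(pᵢ − θ₀pⱼ) = 2^{-xᵢ}2^{-xⱼ}·2^{-|yᵢ−yⱼ|}` = rank one ⊗ PSD; PSD of the AR(1)/Ornstein–Uhlenbeck lattice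
  kernel `2^{-|s−t|}` by the Gram identity `half_pow_natDist_eq`).  By `W(B₂)`-symmetry the same holds for
  `x₁ = 0`.  `K` is moreover positive-definite (a product of AR(1) kernels), i.e. the covariance of a Gaussian
  lattice field whose precision matrix is `⊗_μ`(tridiagonal) — finite-range couplings inside the unit cube, site-RP
  across all four axis hyperplanes, lattice mass gap `ma` per unit = `m` in physical units for EVERY spacing `a`,
  covariance on physical points independent of `a`: an honest RP lattice scaling limit with a uniform lattice gap,
  `W(B₄)`- and translation-invariant, with the OS package along `e₀` and exponential clustering.
* `not_kernelRP_l1_diag`, `not_kernelRP_l1_quadrant`: `K` is NOT RP across the diagonal mirror: the three points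
  `(3,−1), (5,−3), (7,−5)` of the open quadrant `{x₀ > 0 > x₁}` with coefficients `1, −1, 1` have diagonal RP
  form `−7/128` (`diagForm_eq`; axis form of the same configuration `241/16384`, `axisForm_eq`).  Continuum
  mechanism: in light-cone variables the `v`-Fourier transform of the reflected kernel is
  `∝ e^{-cU}[(c/q) sin(qU) + cos(qU)]`, not exponentially convex in `U = u + u'`.

Moral for the crux: diagonal RP of a Wilson limit cannot come from {axis RP ×4, `W(B₄)`, translations, OS
package, continuum gap, uniform lattice gap of SOME RP finite-range regularisation, Gaussianity}; it must come
from the diagonal Schur cut of Wilson's plaquette action (`β ≥ 0`) on a tilted geometry, transported to the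
statement's odd tori.  Barrier candidate `AxisRPNotDiagonalRP`.
[FILS I = Fröhlich–Israel–Lieb–Simon, CMP 62 (1978); FILS II, J. Stat. Phys. 22 (1980), §3 (45° boxes).]
-/

namespace Summit.QuantumFields.YangMills.Theorems.DiagonalMirrorRPR.Negative

namespace L1Kernel

/-- `ℓ¹`-norm on `ℤ²` (the `(x₀,x₁)`-plane of the lattice `ℤ⁴`; `x₂, x₃` are spectators). [folklore] -/
def l1 (v : ℤ × ℤ) : ℕ := v.1.natAbs + v.2.natAbs

/-- The ℓ¹-Gaussian two-point kernel `K(v) = 2^{-‖v‖₁}` (`= e^{-m‖x−y‖₁}` at lattice points, `ma = log 2`). [folklore] -/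
def K (v : ℤ × ℤ) : ℚ := (1 / 2 : ℚ) ^ l1 v

/-- Reflection across the DIAGONAL mirror `x₀ + x₁ = 0` (unit normal `(e₀+e₁)/√2`, the crux's frame
`R e₀ = a e₀ + a e₁`): `(x₀,x₁) ↦ (−x₁,−x₀)`. [folklore] -/
def θd (v : ℤ × ℤ) : ℤ × ℤ := (-v.2, -v.1)

/-- Reflection across the AXIS mirror `x₀ = 0`: `(x₀,x₁) ↦ (−x₀,x₁)`. [folklore] -/
def θ₀ (v : ℤ × ℤ) : ℤ × ℤ := (-v.1, v.2)

/-- **Kernel-level reflection positivity** of a translation-invariant two-point function `C` on `ℤ²` across the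
mirror of the reflection `θ`, for configurations in the region `P` (the open half-space of the mirror, or a
smaller region): every finite real configuration has a non-negative RP form `∑ᵢⱼ cᵢcⱼ C(pᵢ − θpⱼ)`.  This is
exactly degree-`(1,1)` OS positivity `𝔖₂(θf̄ ⊗ f) ≥ 0` for finitely supported `f`. [folklore] -/
def KernelRP (C : ℤ × ℤ → ℚ) (θ : ℤ × ℤ → ℤ × ℤ) (P : ℤ × ℤ → Prop) : Prop :=
  ∀ (n : ℕ) (p : Fin n → ℤ × ℤ) (c : Fin n → ℚ), (∀ i, P (p i)) →
    0 ≤ ∑ i, ∑ j, c i * c j * C (p i - θ (p j))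

/-- Gram vectors of the AR(1)/OU lattice kernel: `φ r S = 2^r (1/2)^S` for `r ≤ S`, else `0`. [folklore] -/
def φ (r S : ℕ) : ℚ := if r ≤ S then (2 : ℚ) ^ r * (1 / 2 : ℚ) ^ S else 0

/-- **Gram identity** for the AR(1)/OU lattice kernel: for `S ≤ M` (and any `T`),
`(1/2)^{|S−T|} = (3/4) ∑_{r ≤ M} φ_r(S) φ_r(T) + (1/2)^{S+1} (1/2)^{T+1}` — the moving-average representation
`X_t = ∑_{r ≤ t} 2^{r−t} ε_r` of the AR(1) process with parameter `1/2`, truncated at `r ≥ 0` with the rank-one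
remainder. [folklore] -/
theorem half_pow_natDist_eq (S T M : ℕ) (hS : S ≤ M) :
    (1 / 2 : ℚ) ^ Int.natAbs ((S : ℤ) - T) =
      3 / 4 * ∑ r ∈ Finset.range (M + 1), φ r S * φ r T + (1 / 2 : ℚ) ^ (S + 1) * (1 / 2) ^ (T + 1) := by
  -- reduce the indicator sum to a geometric sum over `r ≤ min S T`
  have hsum : ∑ r ∈ Finset.range (M + 1), φ r S * φ r T =
      (1 / 2 : ℚ) ^ S * (1 / 2 : ℚ) ^ T * ∑ r ∈ Finset.range (min S T + 1), (4 : ℚ) ^ r := by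
    have hfilter : ∀ r ∈ Finset.range (M + 1), φ r S * φ r T =
        if r ∈ Finset.range (min S T + 1) then (1 / 2 : ℚ) ^ S * (1 / 2 : ℚ) ^ T * (4 : ℚ) ^ r else 0 := by
      intro r _
      by_cases h : r ≤ min S T
      · have h1 : r ≤ S := h.trans (min_le_left _ _)
        have h2 : r ≤ T := h.trans (min_le_right _ _)
        have hr : r ∈ Finset.range (min S T + 1) := Finset.mem_range.2 (Nat.lt_succ_of_le h)
        simp only [φ, h1, h2, hr, ↓reduceIte]
        have h4 : (4 : ℚ) ^ r = 2 ^ r * 2 ^ r := by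
          rw [← mul_pow]; norm_num
        rw [h4]; ring
      · have hr : r ∉ Finset.range (min S T + 1) := by
          rw [Finset.mem_range]; omega
        simp only [hr, ↓reduceIte, φ]
        rcases Nat.lt_or_ge S r with h1 | h1
        · simp [Nat.not_le.2 h1]
        · have h2 : ¬ r ≤ T := by
            intro h2; exact h (le_min h1 h2)
          simp [h2]
    rw [Finset.sum_congr rfl hfilter, ← Finset.sum_filter, Finset.mul_sum]
    congr 1
    ext r
    simp only [Finset.mem_filter, Finset.mem_range]
    omega
  rw [hsum, geom_sum_eq (by norm_num : (4 : ℚ) ≠ 1)]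
  -- both sides equal `(1/2)^(S+T) * 4^(min S T)`
  have hnat : Int.natAbs ((S : ℤ) - T) + 2 * min S T = S + T := by omega
  have key : (1 / 2 : ℚ) ^ Int.natAbs ((S : ℤ) - T) = (1 / 2 : ℚ) ^ S * (1 / 2) ^ T * 4 ^ min S T := by
    have h := congrArg (fun n : ℕ => (1 / 2 : ℚ) ^ n) hnat
    simp only [pow_add, pow_mul] at h
    have h4 : ((1 / 2 : ℚ) ^ 2) ^ min S T * (4 : ℚ) ^ min S T = 1 := by
      rw [← mul_pow]; norm_num
    calc (1 / 2 : ℚ) ^ Int.natAbs ((S : ℤ) - T)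
        = (1 / 2 : ℚ) ^ Int.natAbs ((S : ℤ) - T) * (((1 / 2 : ℚ) ^ 2) ^ min S T * (4 : ℚ) ^ min S T) := by
          rw [h4, mul_one]
      _ = ((1 / 2 : ℚ) ^ Int.natAbs ((S : ℤ) - T) * ((1 / 2 : ℚ) ^ 2) ^ min S T) * (4 : ℚ) ^ min S T := by ring
      _ = (1 / 2 : ℚ) ^ S * (1 / 2) ^ T * 4 ^ min S T := by rw [h]
  rw [key]
  ring

/-- **The AR(1)/OU lattice kernel `(1/2)^{|S−T|}` is positive semi-definite** (Gram representation). [folklore] -/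
theorem psd_half_pow_natDist {n : ℕ} (S : Fin n → ℕ) (d : Fin n → ℚ) :
    0 ≤ ∑ i, ∑ j, d i * d j * (1 / 2 : ℚ) ^ Int.natAbs ((S i : ℤ) - S j) := by
  set M : ℕ := ∑ i, S i with hM
  have hle : ∀ i, S i ≤ M := fun i =>
    Finset.single_le_sum (f := S) (fun _ _ => Nat.zero_le _) (Finset.mem_univ i)
  -- Gram vectors
  set T : ℕ → Fin n → ℚ := fun r i => d i * φ r (S i) with hT
  set U : Fin n → ℚ := fun i => d i * (1 / 2 : ℚ) ^ (S i + 1) with hU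
  have hrw : ∀ i j, d i * d j * (1 / 2 : ℚ) ^ Int.natAbs ((S i : ℤ) - S j) =
      3 / 4 * ∑ r ∈ Finset.range (M + 1), T r i * T r j + U i * U j := by
    intro i j
    rw [half_pow_natDist_eq (S i) (S j) M (hle i)]
    simp only [hT, hU, mul_add, Finset.mul_sum]
    congr 1
    · exact Finset.sum_congr rfl fun r _ => by ring
    · ring
  have hD : ∑ i, ∑ j, ∑ r ∈ Finset.range (M + 1), T r i * T r j =
      ∑ r ∈ Finset.range (M + 1), (∑ i, T r i) * (∑ j, T r j) := by
    calc ∑ i, ∑ j, ∑ r ∈ Finset.range (M + 1), T r i * T r j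
        = ∑ i, ∑ r ∈ Finset.range (M + 1), ∑ j, T r i * T r j :=
          Finset.sum_congr rfl fun i _ => Finset.sum_comm
      _ = ∑ r ∈ Finset.range (M + 1), ∑ i, ∑ j, T r i * T r j := Finset.sum_comm
      _ = ∑ r ∈ Finset.range (M + 1), (∑ i, T r i) * (∑ j, T r j) :=
          Finset.sum_congr rfl fun r _ => by rw [Finset.sum_mul_sum]
  rw [show ∑ i, ∑ j, d i * d j * (1 / 2 : ℚ) ^ Int.natAbs ((S i : ℤ) - S j) =
      ∑ i, ∑ j, (3 / 4 * ∑ r ∈ Finset.range (M + 1), T r i * T r j + U i * U j) from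
    Finset.sum_congr rfl fun i _ => Finset.sum_congr rfl fun j _ => hrw i j]
  simp only [Finset.sum_add_distrib]
  refine add_nonneg ?_ ?_
  · simp only [← Finset.mul_sum]
    rw [hD]
    exact mul_nonneg (by norm_num) (Finset.sum_nonneg fun r _ => mul_self_nonneg _)
  · rw [← Finset.sum_mul_sum]
    exact mul_self_nonneg _

/-- **The ℓ¹-Gaussian kernel IS reflection positive across the AXIS mirror `x₀ = 0`, on every finite
configuration in `{x₀ > 0}`**: `K(pᵢ − θ₀pⱼ) = (1/2)^{xᵢ}(1/2)^{xⱼ}·(1/2)^{|yᵢ−yⱼ|}` is (rank one) ⊗ (PSD).  By the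
`W(B₂)`-symmetry of `K` the same holds for the mirror `x₁ = 0`; contrast `not_kernelRP_l1_diag`. [folklore] -/
theorem kernelRP_l1_axis : KernelRP K θ₀ (fun v => 0 < v.1) := by
  intro n p c hp
  -- shift the `y`-coordinates to naturals
  set B : ℤ := -∑ i, |(p i).2| with hB
  have hBle : ∀ i, B ≤ (p i).2 := fun i => by
    have h1 : |(p i).2| ≤ ∑ j, |(p j).2| :=
      Finset.single_le_sum (f := fun j => |(p j).2|) (fun _ _ => abs_nonneg _) (Finset.mem_univ i)
    have h2 : -|(p i).2| ≤ (p i).2 := neg_abs_le _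
    omega
  let S : Fin n → ℕ := fun i => ((p i).2 - B).toNat
  have hS : ∀ i, (S i : ℤ) = (p i).2 - B := fun i => Int.toNat_of_nonneg (by linarith [hBle i])
  let X : Fin n → ℕ := fun i => ((p i).1).toNat
  have hX : ∀ i, (X i : ℤ) = (p i).1 := fun i => Int.toNat_of_nonneg (hp i).le
  have hK : ∀ i j, K (p i - θ₀ (p j)) =
      (1 / 2 : ℚ) ^ X i * (1 / 2 : ℚ) ^ X j * (1 / 2 : ℚ) ^ Int.natAbs ((S i : ℤ) - S j) := by
    intro i j
    simp only [K, l1, θ₀, Prod.fst_sub, Prod.snd_sub, sub_neg_eq_add]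
    have h1 : ((p i).1 + (p j).1).natAbs = X i + X j := by
      have := hX i; have := hX j; omega
    have h2 : ((p i).2 - (p j).2).natAbs = Int.natAbs ((S i : ℤ) - S j) := by
      rw [hS i, hS j]; congr 1; ring
    rw [h1, h2, pow_add, pow_add]
  simp_rw [hK]
  have := psd_half_pow_natDist S (fun i => c i * (1 / 2 : ℚ) ^ X i)
  convert this using 2 with i _
  refine Finset.sum_congr rfl fun j _ => ?_
  ring

/-- The witness configuration: three points of the open quadrant `{x₀ > 0 > x₁}` on the diagonal-time slice
`x₀ + x₁ = 2`, spaced by `2(e₀ − e₁)` (a period-4 stagger along the mirror, i.e. `v`-momentum `q` with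
`2nq = π` in the Fourier computation of the section docstring). [folklore] -/
def wPts : Fin 3 → ℤ × ℤ := ![(3, -1), (5, -3), (7, -5)]

/-- The witness coefficients `1, −1, 1`. [folklore] -/
def wCoef : Fin 3 → ℚ := ![1, -1, 1]

/-- The witness lies in the open quadrant `{x₀ > 0 > x₁}`. [folklore] -/
theorem wPts_quadrant : ∀ i, 0 < (wPts i).1 ∧ (wPts i).2 < 0 := by decide

/-- The witness lies in the open half-space `{x₀ + x₁ > 0}` of the diagonal mirror. [folklore] -/
theorem wPts_halfspace : ∀ i, 0 < (wPts i).1 + (wPts i).2 := by decide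

/-- The witness lies in the open half-space `{x₀ > 0}` of the axis mirror. [folklore] -/
theorem wPts_axis_halfspace : ∀ i, 0 < (wPts i).1 := by decide

/-- **Exact value of the diagonal RP form on the witness: `−7/128`.**  (Gram entries `K(pᵢ − θ_d pⱼ)`:
`1/16` on and next to the diagonal, `1/256` in the corners; `3/16 − 4/16 + 2/256 = −7/128`.) [folklore] -/
theorem diagForm_eq : ∑ i, ∑ j, wCoef i * wCoef j * K (wPts i - θd (wPts j)) = -7 / 128 := by
  simp [Fin.sum_univ_three, wPts, wCoef, K, l1, θd]
  norm_num

/-- Sanity / contrast: the AXIS RP form of the same configuration is `241/16384 > 0` (as it must be: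
`kernelRP_l1_axis`). [folklore] -/
theorem axisForm_eq : ∑ i, ∑ j, wCoef i * wCoef j * K (wPts i - θ₀ (wPts j)) = 241 / 16384 := by
  simp [Fin.sum_univ_three, wPts, wCoef, K, l1, θ₀]
  norm_num

/-- **The ℓ¹-Gaussian two-point function is not diagonally RP, already on the open quadrant `{x₀ > 0 > x₁}`**
(so the quadrant / `*`-semigroup `((0,∞)², +, (a,b)* = (b,a))` form of swap positivity fails for it too). [folklore] -/
theorem not_kernelRP_l1_quadrant : ¬ KernelRP K θd (fun v => 0 < v.1 ∧ v.2 < 0) := fun h => by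
  have h1 := h 3 wPts wCoef wPts_quadrant
  rw [diagForm_eq] at h1
  norm_num at h1

/-- **The ℓ¹-Gaussian two-point function `2^{-‖x−y‖₁}` — axis-RP in all four axes, `W(B₄)`-invariant,
exponentially clustering, an honest finite-range RP lattice scaling limit with a uniform lattice gap — is NOT
reflection positive across the diagonal mirror `x₀ + x₁ = 0`.**  Diagonal RP is action-specific. [folklore] -/
theorem not_kernelRP_l1_diag : ¬ KernelRP K θd (fun v => 0 < v.1 + v.2) := fun h => by
  have h1 := h 3 wPts wCoef wPts_halfspace
  rw [diagForm_eq] at h1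
  norm_num at h1

end L1Kernel

end Summit.QuantumFields.YangMills.Theorems.DiagonalMirrorRPR.Negative
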